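import Literature.MathematicalPhysics.QuantumFieldTheory.Balaban1983to89.B9CubeSequence408
import Literature.MathematicalPhysics.QuantumFieldTheory.Balaban1983to89.B6CubeWindowV1
import Literature.MathematicalPhysics.QuantumFieldTheory.Balaban1983to89.B6Cover236MultiLevelBlocksL0

/-!
# `Balaban1983to89.B9CubeV1Data` — V1 INDEX DATA OF THE CUBE SEQUENCE `{Ω_n(□)}` OF [B9] SECT. C, PART 1: ITS COVER CUBES ARE PLACED
# (the hypothesis `∀ c : cubes, Placed ℓ k P′ c` of the `…V1L0` lineage — `B6Cor28EntriesKLevelV1L0.cor28_kLevel_H`, Prop. 2.6∕2.7 — for the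
# cube family of `B9CubeSequence408`, from the member's): the top-level cover cubes of the cube sequence are cover cubes of the member, the
# others are placed automatically (sub-row G-B9-LETTERS, module M5.1c part 2, prerequisite (P1) of the bond sector `G_□(U)`, `C_□(U)`)

FRAMING (verbatim cell line):
statement-level skeleton of published theorems with citation tags; proofs where landed; nothing here is a claim about the Yang–Mills mass gap

Sources under audit (cell lit-balaban): T. Bałaban, *Propagators for lattice gauge theories in a background field*, Commun. Math. Phys. **99**
(1985) 389–434 [`Balaban1985BackgroundPropagators`, "B9"], Sect. C pp. 408–409; T. Bałaban, *Propagators and renormalization transformations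
for lattice gauge theories. II*, Commun. Math. Phys. **96** (1984) 223–250 [`Balaban1984PropagatorsII`, "[4]"], p. 229 (the cover by cubes □),
Cor. 2.8 p. 249.  Unit `lit-balaban-r05` (r05 gen 77).

## WHAT IS PRINTED (verbatim up to notation)

[B9] p. 409 l. 1–5: «The operators constructed for this sequence, which we denote by G′_□(U), C_□(U) = (Q′(U)G′_□²(U)Q′*(U))⁻¹, G_□(U), satisfy all the
inequalities of Theorems 3.1–3.3» — Thm 3.3 (the vector `G_□`) at `U = 1` is [4] Prop. 2.6 ∕ 2.7 ∕ Cor. 2.8 for the cube sequence; [4] p. 229: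
«cubes □ of the size 2ML^jη, each cube being a sum of 2^d big blocks with a center y ∈ Λ_j».

## WHAT THIS FILE CERTIFIES (kernel-checked; `F := cubeFam D q …`, member `D : B6MultiLevelTorusOperator.TDomains`)

* `mem_cubes_of_cubeFam_top` — a cover cube of `F` OF THE TOP LEVEL `k` is a cover cube of `D` (where `lev_F = k`, `lev_D = k`);
* `fst_le_of_mem_cubes_cubeFam` — cover cubes of `F` have level `≤ k`;
* ★ `placed_cubeFam` — if the member's cover cubes are placed (def-Y's `KIdx.hpl`) and `P′ ≥ 5`, EVERY cover cube of `F` is placed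
  (`B6CubeWindowV1.Placed`; below the top level by `placed_of_lt`).

## HONEST SCOPE

* Bookkeeping only; the remaining V1 data of the cube sequence (bond weights `w_□` in the global band, equal to the member's on the index bonds near
  □ — prerequisite (P2)) and the bond-sector letters themselves are NOT in this file.
* Nothing is inferred from the manuscript; kernel-checked.  NOT summit progress; the YM mass gap is not proved by any of this.
-/

namespace Literature.MathematicalPhysics.QuantumFieldTheory.Balaban1983to89.B9CubeV1Data

open Literature.MathematicalPhysics.QuantumFieldTheory.Balaban1983to89.B4Reflection242 (boxDom blk)
open Literature.MathematicalPhysics.QuantumFieldTheory.Balaban1983to89.B6MultiLevelBoxOperator (N0 bigSide)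
open Literature.MathematicalPhysics.QuantumFieldTheory.Balaban1983to89.B6Cover236MultiLevelBlocks (cubes)
open Literature.MathematicalPhysics.QuantumFieldTheory.Balaban1983to89.B6CubeWindowV1 (Placed placed_of_lt)
open Literature.MathematicalPhysics.QuantumFieldTheory.Balaban1983to89.B9CubeSequence408 (cubeFam lev_cubeFam_le)

variable {d ℓ Mh k R : ℕ} {P : Fin (d + 1) → ℕ} {D : B6MultiLevelTorusOperator.TDomains d ℓ Mh k P R} {q : ↥(cubes D.toDomains)}
  {hL : Odd (ℓ + 1)} {hM : Odd Mh} {hMh : 1 ≤ Mh} {hP : ∀ μ, 1 ≤ P μ}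

/-- cover cubes of the cube sequence have level `≤ k`. [cite: Balaban1984PropagatorsII, p.229, (2.3)–(2.4) p.224, bookkeeping] -/
theorem fst_le_of_mem_cubes_cubeFam {c : ℕ × (Fin (d + 1) → ℤ)}
    (hc : c ∈ B6Cover236MultiLevelBlocksL0.cubes (cubeFam D q hL hM hMh hP).toDomains) : c.1 ≤ k := by
  obtain ⟨x, _, rfl⟩ := Finset.mem_image.1 hc
  exact (cubeFam D q hL hM hMh hP).lev_le x

/-- **A TOP-LEVEL COVER CUBE OF THE CUBE SEQUENCE IS A COVER CUBE OF THE MEMBER**: where `lev_F x = k` also `lev_D x = k` (`lev_F ≤ lev_D ≤ k`).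
[cite: Balaban1985BackgroundPropagators, p.408 (Ω_{j+1}(□) = □³ ∩ B^{j+1}(Λ_{j+1})); Balaban1984PropagatorsII, p.229] -/
theorem mem_cubes_of_cubeFam_top {c : ℕ × (Fin (d + 1) → ℤ)}
    (hc : c ∈ B6Cover236MultiLevelBlocksL0.cubes (cubeFam D q hL hM hMh hP).toDomains) (hk : c.1 = k) :
    c ∈ cubes D.toDomains := by
  obtain ⟨x, hx, rfl⟩ := Finset.mem_image.1 hc
  have hle : (cubeFam D q hL hM hMh hP).lev x ≤ D.lev x := lev_cubeFam_le x
  have hDk : D.lev x ≤ k := D.lev_le x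
  have hFk : (cubeFam D q hL hM hMh hP).lev x = k := hk
  have hD : D.lev x = (cubeFam D q hL hM hMh hP).lev x := by omega
  refine Finset.mem_image.2 ⟨x, hx, ?_⟩
  show (D.lev x, blk (bigSide ℓ Mh (D.lev x)) x) =
    ((cubeFam D q hL hM hMh hP).lev x, blk (bigSide ℓ Mh ((cubeFam D q hL hM hMh hP).lev x)) x)
  rw [hD]

/-- ★ **THE COVER CUBES OF THE CUBE SEQUENCE ARE PLACED** (`P′ ≥ 5`, the member's cover cubes placed): below the top level automatically
(`placed_of_lt`), at the top level because they are the member's. [cite: Balaban1984PropagatorsII, p.229, p.238 (charts); Balaban1985BackgroundPropagators, p.409 l.1–5 (Thm 3.3 for G_□)] -/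
theorem placed_cubeFam (hP5 : ∀ μ, 5 ≤ P μ) (hpl : ∀ c : ↥(cubes D.toDomains), Placed ℓ k P c.1)
    (c : ↥(B6Cover236MultiLevelBlocksL0.cubes (cubeFam D q hL hM hMh hP).toDomains)) : Placed ℓ k P c.1 := by
  rcases Nat.lt_or_ge c.1.1 k with hlt | hge
  · exact placed_of_lt hP5 c.1 hlt
  · have hk : c.1.1 = k := le_antisymm (fst_le_of_mem_cubes_cubeFam c.2) hge
    exact hpl ⟨c.1, mem_cubes_of_cubeFam_top c.2 hk⟩

end Literature.MathematicalPhysics.QuantumFieldTheory.Balaban1983to89.B9CubeV1Data
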